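import Mathlib
import Literature.LinearAlgebra.Matrix.SylvesterDeterminantIdentity
import Summits.ValiantsHypothesis.ValiantsHypothesis.Theorems.LacunarySymmetroidMatrixDescartesCensusDefs

/-!
# Tower graft line — KERNEL CONFINEMENT: compressions of a pencil are in class, and the ROTATION COUNT as a charge (handle (h4))

Mechanism file for the line `Cruxes/WeakLifting/Lines/tower_graft.lean` (crux `WeakLifting` = stmt-ValiantsHypothesis-19561,
restricted sub-case `TowerWeakLifting`; size-induction spine S4f `stub_sizeDoublingPoly` / T5 side).  NO stub is claimed.  It types
handle **(h4)** of the planner's memo `Lines/tower_graft-S5.md` §6 (rev 2f, val-idea-24 g0: «`vᵀ𝔅(t)v = det(PᵀG(t)P)`, `P = [e_M | v]` —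
every 1-dim compression of the Sylvester pencil is a size-`s` class determinant on the SAME support, and `det(PᵀGP)` is in the class for
every real `n × s` matrix `P`; the gap to `det 𝔅` is EIGENVECTOR ROTATION of `ker G(t)` along `t`») and turns the informal «rotation» into
a named charge with a proved law at its finite end:

* §1 `transpose_mul_pencil_mul_rect`, `card_posRoots_det_compression_le` — a rectangular congruence-compression of a lacunary pencil
  by CONSTANT real matrices acts letterwise, `Q̂ᵀ(∑ X^{dₗ}•Sₗ)Q̂ = ∑ X^{dₗ}•(QᵀSₗQ)`, so `det(Q̂ᵀGQ̂)` is the determinant of a symmetric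
  `s`-pencil on the same support and `Z₊(det(Q̂ᵀGQ̂)) ≤ B` under `PosRootLawOn s K B d` (CLASS CLOSURE UNDER COMPRESSION; the letters
  may be indexed by any `s`-element type, `card_posRoots_det_pencil_le_of_equiv`).
* §2 `card_posRoots_det_le_of_kernel_confined`, `…_le_sum_of_kernel_confined` and the class reading — KERNEL CONFINEMENT LAWS: if at
  every positive root `t` of `det M` the real matrix `M(t)` has a kernel vector in the column span of a constant real `Q` (resp. of one of
  finitely many `Q a`), then `Z₊(det M) ≤ Z₊(det Q̂ᵀMQ̂)` (resp. `≤ ∑ₐ Z₊(det Q̂ₐᵀMQ̂ₐ)`), provided those compressed determinants are not the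
  zero polynomial; for a symmetric pencil the right-hand sides are class budgets at the SMALLER sizes `|Q a|` — «size drops to the
  dimension of the confining subspace», no pivot and no Schur complement needed (`Matrix.exists_mulVec_eq_zero_iff`).
* §3 `dotProduct_borderedMinors_mulVec` (any commutative ring) — COMPRESSIONS OF THE BORDERED-MINOR MATRIX ARE BORDERED DETERMINANTS:
  `v ⬝ᵥ (𝔅 *ᵥ w) = det [[P, B w], [vᵀC, vᵀDw]]` (bilinearity of `det A[α ∪ {i}, α ∪ {j}]` in the border, via `det_updateCol_add/smul`),
  `= det ([1 0; 0 vᵀ] · A · [1 0; 0 w])` (`dotProduct_borderedMinors_mulVec_eq_det_compress`, matrix form).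
* §4 `card_posRoots_compression_borderedMinors_le` — (h4) VERBATIM in class currency: for the Sylvester minor pencil `𝔅` of a symmetric
  `N`-pencil split along `e : ι ⊕ μ ≃ Fin N`, `Z₊(vᵀ𝔅v) ≤ B(|ι|+1; d)` for every constant real `v`; and the headline
  `card_posRoots_pencil_le_card_mul_of_kernel_directions` — THE ROTATION-COUNT LAW: if the `μ`-parts of the kernel vectors of `G(t)` at
  the positive roots of `det G` point in at most `|fam|` fixed real directions `v a` (no compression `(v a)ᵀ𝔅(v a)` vanishing identically),
  then `Z₊(det G) ≤ |fam| · B(|ι|+1; d)`.  In the size-doubling split `N = 2s−1`, `|ι| = s−1` the budget on the right is the size-`s`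
  budget: ZERO/FINITE ROTATION is exactly the regime where Sylvester's presentation pays the class price the memo wants; what a
  structure-charged T5 must bound is how many directions (or low-dimensional subspaces, §2) the kernels of a TOWER pencil visit along `t > 0`.

Def-free; Mathlib + `Literature/LinearAlgebra/Matrix/SylvesterDeterminantIdentity.lean` (`borderedMinors`) + the cell's `…CensusDefs`
(`PosRootLawOn`).  Vocabulary matches lift-p2 g18 `…TowerGraftSylvesterCompression.lean` / lift-p3 g17 `…TowerGraftMinorPencil.lean`
(`A := G.submatrix e e`, `𝔅 = borderedMinors A.toBlocks₁₁ A.toBlocks₁₂ A.toBlocks₂₁ A.toBlocks₂₂`).  HONEST FRAMING: elementary linear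
algebra and union bounds that NAME the rotation charge; nothing here bounds the rotation of a tower pencil, and T5, S4f
(`TowerSizeDoublingPoly`), TowerB, `WeakLifting`, Conjecture B / `KPlusLogSqLaw`, `MatrixDescartes` (18050) and `VP ≠ VNP` are untouched.
Seat: prover val-sym-lift-p3 g18, `--supports stmt-ValiantsHypothesis-19561`.
-/

-- `Summit.ValiantsHypothesis.ValiantsHypothesis.…` repeats a component by the D-0017 layout
-- (single-conjunct summit), which the `dupNamespace` linter flags; the name is mandated.
set_option linter.dupNamespace false

namespace Summit.ValiantsHypothesis.ValiantsHypothesis.Theorems.KPlusLogSqLaw.TowerGraft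

open Finset Polynomial Matrix
open scoped BigOperators Polynomial
open Summit.ValiantsHypothesis.ValiantsHypothesis.Theorems.LacunarySymmetroidMatrixDescartes (PosRootLawOn)
open Literature.LinearAlgebra.Matrix (borderedMinors borderedMinors_apply)

/-! ## §1 Rectangular compressions of a lacunary pencil are pencils on the same support -/

section Compression

variable {K : ℕ}

/-- rectangular compression acts letterwise: `Q̂ᵀ (∑ X^{dₗ} • Sₗ) Q̂' = ∑ X^{dₗ} • (Qᵀ Sₗ Q')` for CONSTANT real `Q`, `Q'`
(`Q̂ = Q.map C`). [folklore] -/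
theorem transpose_mul_pencil_mul_rect {n r r' : Type*} [Fintype n] [Fintype r] [Fintype r']
    (Q : Matrix n r ℝ) (Q' : Matrix n r' ℝ) (d : Fin K → ℕ) (S : Fin K → Matrix n n ℝ) :
    (Q.map Polynomial.C)ᵀ * (∑ l, ((X : ℝ[X]) ^ d l) • (S l).map Polynomial.C) * Q'.map Polynomial.C =
      ∑ l, ((X : ℝ[X]) ^ d l) • (Qᵀ * S l * Q').map Polynomial.C := by
  simp only [Matrix.mul_sum, Matrix.sum_mul, Matrix.mul_smul, Matrix.smul_mul, Matrix.map_mul, Matrix.transpose_map]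

/-- a congruence-compression of a symmetric letter is symmetric. [folklore] -/
theorem isSymm_transpose_mul_mul {n r : Type*} [Fintype n] (Q : Matrix n r ℝ) {S : Matrix n n ℝ} (hS : S.IsSymm) :
    (Qᵀ * S * Q).IsSymm := by
  rw [Matrix.IsSymm, Matrix.transpose_mul, Matrix.transpose_mul, Matrix.transpose_transpose, hS.eq, Matrix.mul_assoc]

/-- the class law is invariant under re-indexing the rows/columns of the letters along `e : n ≃ Fin s`:
a symmetric `K`-pencil on the support `d` with letters indexed by ANY `s`-element type has at most `B` distinct positive
zeros of its determinant when `PosRootLawOn s K B d`. [folklore] -/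
theorem card_posRoots_det_pencil_le_of_equiv {n : Type*} [Fintype n] [DecidableEq n] {s B : ℕ} {d : Fin K → ℕ}
    (e : n ≃ Fin s) (hB : PosRootLawOn s K B d) (T : Fin K → Matrix n n ℝ) (hT : ∀ l, (T l).IsSymm) :
    ((∑ l, ((X : ℝ[X]) ^ d l) • (T l).map Polynomial.C).det.roots.toFinset.filter (fun t => 0 < t)).card ≤ B := by
  have h := hB (fun l => (T l).submatrix e.symm e.symm) (fun l => (hT l).submatrix _)
  have hre : (∑ l, ((X : ℝ[X]) ^ d l) • ((T l).submatrix e.symm e.symm).map Polynomial.C) =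
      (∑ l, ((X : ℝ[X]) ^ d l) • (T l).map Polynomial.C).submatrix e.symm e.symm := by
    ext i j
    simp [Matrix.submatrix_apply, Matrix.sum_apply, Matrix.smul_apply]
  rwa [hre, Matrix.det_submatrix_equiv_self] at h

/-- **CLASS CLOSURE UNDER COMPRESSION.**  If `PosRootLawOn s K B d` and `Q` is ANY constant real `N × n` matrix with `|n| = s`
(`e : n ≃ Fin s`), then the compressed pencil `Q̂ᵀ G Q̂` of a symmetric `N`-pencil `G = ∑ X^{dₗ} • Sₗ` on `d` — itself the symmetric
`s`-pencil `∑ X^{dₗ} • (QᵀSₗQ)` on the SAME support — has at most `B` distinct positive zeros of its determinant: `Z₊(det(QᵀGQ)) ≤ B(s; d)`.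
(Memo `Lines/tower_graft-S5.md` §6 handle (h4): «`det(PᵀGP)` is in the class for every real `n × s` matrix `P`».) [this work] -/
theorem card_posRoots_det_compression_le {n : Type*} [Fintype n] [DecidableEq n] {N s B : ℕ} {d : Fin K → ℕ}
    (e : n ≃ Fin s) (hB : PosRootLawOn s K B d) (S : Fin K → Matrix (Fin N) (Fin N) ℝ) (hS : ∀ l, (S l).IsSymm)
    (Q : Matrix (Fin N) n ℝ) :
    (((Q.map Polynomial.C)ᵀ * (∑ l, ((X : ℝ[X]) ^ d l) • (S l).map Polynomial.C) * Q.map Polynomial.C).det.roots.toFinset.filter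
      (fun t => 0 < t)).card ≤ B := by
  rw [transpose_mul_pencil_mul_rect]
  exact card_posRoots_det_pencil_le_of_equiv e hB _ (fun l => isSymm_transpose_mul_mul Q (hS l))

end Compression

/-! ## §2 Kernel confinement: a root whose kernel vector lies in `range Q` is a root of the compressed determinant -/

section Confinement

variable {n : Type*} [Fintype n] [DecidableEq n]

omit [DecidableEq n] in
/-- evaluating a compressed polynomial matrix at a real point: `(Q̂ᵀ M Q̂')(t) = Qᵀ M(t) Q'`. [folklore] -/
theorem map_eval_compression {r r' : Type*} [Fintype r] [Fintype r'] (Q : Matrix n r ℝ) (Q' : Matrix n r' ℝ)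
    (M : Matrix n n ℝ[X]) (t : ℝ) :
    ((Q.map Polynomial.C)ᵀ * M * Q'.map Polynomial.C).map (Polynomial.eval t) = Qᵀ * M.map (Polynomial.eval t) * Q' := by
  ext i j
  simp only [Matrix.map_apply, Matrix.mul_apply, Matrix.transpose_apply, Polynomial.eval_finsetSum, Polynomial.eval_mul,
    Polynomial.eval_C]

omit [DecidableEq n] in
/-- **a real kernel vector of `M(t)` inside the column span of the constant matrix `Q` kills the compressed determinant
`det (Q̂ᵀ M Q̂)` at `t`.** [folklore] -/
theorem eval_det_compression_eq_zero {r : Type*} [Fintype r] [DecidableEq r] (M : Matrix n n ℝ[X]) (Q : Matrix n r ℝ)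
    (t : ℝ) (u : r → ℝ) (hu : u ≠ 0) (h : M.map (Polynomial.eval t) *ᵥ (Q *ᵥ u) = 0) :
    Polynomial.eval t ((Q.map Polynomial.C)ᵀ * M * Q.map Polynomial.C).det = 0 := by
  rw [← Polynomial.coe_evalRingHom, RingHom.map_det, RingHom.mapMatrix_apply, Polynomial.coe_evalRingHom,
    map_eval_compression]
  have hker : (Qᵀ * M.map (Polynomial.eval t) * Q) *ᵥ u = 0 := by
    rw [← Matrix.mulVec_mulVec, ← Matrix.mulVec_mulVec, h, Matrix.mulVec_zero]
  exact Matrix.exists_mulVec_eq_zero_iff.mp ⟨u, hu, hker⟩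

/-- **KERNEL CONFINEMENT LAW (one subspace).**  Let `M` be a square real polynomial matrix and `Q` a CONSTANT real `n × r`
matrix with `det (Q̂ᵀ M Q̂) ≢ 0`.  If at every positive root `t` of `det M` the real matrix `M(t)` has a kernel vector in the
column span of `Q`, then `Z₊(det M) ≤ Z₊(det (Q̂ᵀ M Q̂))`: the count drops to a size-`r` determinant.  (For a lacunary pencil
the right-hand side is a class determinant of size `r` on the same support, `card_posRoots_det_compression_le`.) [this work] -/
theorem card_posRoots_det_le_of_kernel_confined {r : Type*} [Fintype r] [DecidableEq r] (M : Matrix n n ℝ[X])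
    (Q : Matrix n r ℝ) (hQ : ((Q.map Polynomial.C)ᵀ * M * Q.map Polynomial.C).det ≠ 0)
    (h : ∀ t : ℝ, 0 < t → M.det.IsRoot t → ∃ u : r → ℝ, u ≠ 0 ∧ M.map (Polynomial.eval t) *ᵥ (Q *ᵥ u) = 0) :
    (M.det.roots.toFinset.filter (fun t => 0 < t)).card ≤
      (((Q.map Polynomial.C)ᵀ * M * Q.map Polynomial.C).det.roots.toFinset.filter (fun t => 0 < t)).card := by
  refine Finset.card_le_card fun t ht => ?_
  rw [Finset.mem_filter, Multiset.mem_toFinset] at ht ⊢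
  obtain ⟨hroot, hpos⟩ := ht
  have hM : M.det ≠ 0 := (Polynomial.mem_roots'.mp hroot).1
  obtain ⟨u, hu, hk⟩ := h t hpos ((Polynomial.mem_roots hM).mp hroot)
  exact ⟨(Polynomial.mem_roots hQ).mpr (eval_det_compression_eq_zero M Q t u hu hk), hpos⟩

/-- **KERNEL CONFINEMENT LAW (finitely many subspaces) — the ROTATION COUNT as the charge.**  If at every positive root `t`
of `det M` some kernel vector of `M(t)` lies in the column span of one of the constant real matrices `Q a` (`a ∈ s`), each with
`det (Q̂ₐᵀ M Q̂ₐ) ≢ 0`, then `Z₊(det M) ≤ ∑_{a ∈ s} Z₊(det (Q̂ₐᵀ M Q̂ₐ))`. [this work] -/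
theorem card_posRoots_det_le_sum_of_kernel_confined {α : Type*} (s : Finset α) {r : α → Type*}
    [∀ a, Fintype (r a)] [∀ a, DecidableEq (r a)] (M : Matrix n n ℝ[X]) (Q : ∀ a, Matrix n (r a) ℝ)
    (hQ : ∀ a ∈ s, (((Q a).map Polynomial.C)ᵀ * M * (Q a).map Polynomial.C).det ≠ 0)
    (h : ∀ t : ℝ, 0 < t → M.det.IsRoot t →
      ∃ a ∈ s, ∃ u : r a → ℝ, u ≠ 0 ∧ M.map (Polynomial.eval t) *ᵥ (Q a *ᵥ u) = 0) :
    (M.det.roots.toFinset.filter (fun t => 0 < t)).card ≤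
      ∑ a ∈ s, ((((Q a).map Polynomial.C)ᵀ * M * (Q a).map Polynomial.C).det.roots.toFinset.filter (fun t => 0 < t)).card := by
  classical
  refine le_trans (Finset.card_le_card (fun t ht => ?_)) Finset.card_biUnion_le
  rw [Finset.mem_filter, Multiset.mem_toFinset] at ht
  obtain ⟨hroot, hpos⟩ := ht
  have hM : M.det ≠ 0 := (Polynomial.mem_roots'.mp hroot).1
  obtain ⟨a, ha, u, hu, hk⟩ := h t hpos ((Polynomial.mem_roots hM).mp hroot)
  rw [Finset.mem_biUnion]
  refine ⟨a, ha, ?_⟩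
  rw [Finset.mem_filter, Multiset.mem_toFinset]
  exact ⟨(Polynomial.mem_roots (hQ a ha)).mpr (eval_det_compression_eq_zero M (Q a) t u hu hk), hpos⟩

variable {K : ℕ}

/-- **CLASS READING: `Z₊(det G) ≤ ∑ₐ Bₐ`** for a symmetric `N`-pencil `G = ∑ X^{dₗ} • Sₗ` on `d` whose kernels at the positive roots of
`det G` are confined to the column spans of constant real matrices `Q a` of widths `s a` (`a ∈ fam`, compressed determinants `≢ 0`), with
`PosRootLawOn (s a) K (B a) d` — the size drops from `N` to the widths; with all `s a = s` this is «number of confining subspaces × class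
budget at size `s`». [this work] -/
theorem card_posRoots_pencil_le_sum_of_kernel_confined {α : Type*} (fam : Finset α) {r : α → Type*}
    [∀ a, Fintype (r a)] [∀ a, DecidableEq (r a)] {N : ℕ} {d : Fin K → ℕ} (s B : α → ℕ)
    (e : ∀ a, r a ≃ Fin (s a)) (hB : ∀ a ∈ fam, PosRootLawOn (s a) K (B a) d)
    (S : Fin K → Matrix (Fin N) (Fin N) ℝ) (hS : ∀ l, (S l).IsSymm) (Q : ∀ a, Matrix (Fin N) (r a) ℝ)
    (hQ : ∀ a ∈ fam, (((Q a).map Polynomial.C)ᵀ * (∑ l, ((X : ℝ[X]) ^ d l) • (S l).map Polynomial.C) *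
      (Q a).map Polynomial.C).det ≠ 0)
    (h : ∀ t : ℝ, 0 < t → (∑ l, ((X : ℝ[X]) ^ d l) • (S l).map Polynomial.C).det.IsRoot t →
      ∃ a ∈ fam, ∃ u : r a → ℝ, u ≠ 0 ∧
        (∑ l, ((X : ℝ[X]) ^ d l) • (S l).map Polynomial.C).map (Polynomial.eval t) *ᵥ (Q a *ᵥ u) = 0) :
    ((∑ l, ((X : ℝ[X]) ^ d l) • (S l).map Polynomial.C).det.roots.toFinset.filter (fun t => 0 < t)).card ≤
      ∑ a ∈ fam, B a :=
  (card_posRoots_det_le_sum_of_kernel_confined fam _ Q hQ h).trans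
    (Finset.sum_le_sum fun a ha => card_posRoots_det_compression_le (e a) (hB a ha) S hS (Q a))

end Confinement

/-! ## §3 The Sylvester minor pencil: compressions of `𝔅` are bordered determinants, i.e. compressed determinants (handle (h4)) -/

section Bordered

variable {R : Type*} [CommRing R] {ι μ ν : Type*} [Fintype ι] [DecidableEq ι]

/-- a linear combination put into one column: `det` is linear in each column. [folklore] -/
theorem det_updateCol_finset_sum {o : Type*} [Fintype o] [DecidableEq o] (M : Matrix o o R) (j : o) {α : Type*}
    (s : Finset α) (c : α → R) (x : α → o → R) :
    (M.updateCol j (∑ a ∈ s, c a • x a)).det = ∑ a ∈ s, c a * (M.updateCol j (x a)).det := by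
  classical
  induction s using Finset.induction_on with
  | empty =>
    rw [Finset.sum_empty, Finset.sum_empty]
    exact Matrix.det_eq_zero_of_column_eq_zero j (fun i => by simp)
  | insert a s ha ih =>
    rw [Finset.sum_insert ha, Finset.sum_insert ha, Matrix.det_updateCol_add, Matrix.det_updateCol_smul, ih]

/-- a linear combination put into one row: `det` is linear in each row. [folklore] -/
theorem det_updateRow_finset_sum {o : Type*} [Fintype o] [DecidableEq o] (M : Matrix o o R) (j : o) {α : Type*}
    (s : Finset α) (c : α → R) (x : α → o → R) :
    (M.updateRow j (∑ a ∈ s, c a • x a)).det = ∑ a ∈ s, c a * (M.updateRow j (x a)).det := by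
  classical
  induction s using Finset.induction_on with
  | empty =>
    rw [Finset.sum_empty, Finset.sum_empty]
    exact Matrix.det_eq_zero_of_row_eq_zero j (fun i => by simp)
  | insert a s ha ih =>
    rw [Finset.sum_insert ha, Finset.sum_insert ha, Matrix.det_updateRow_add, Matrix.det_updateRow_smul, ih]

omit [CommRing R] [Fintype ι] in
/-- the matrix `P` bordered by the column `x`, the row `y` and the corner `z`, as a COLUMN update. [folklore] -/
theorem bordered_eq_updateCol (P : Matrix ι ι R) (x y : ι → R) (z : R) (X₀ : Matrix ι Unit R) (Z₀ : Matrix Unit Unit R) :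
    Matrix.fromBlocks P (replicateCol Unit x) (replicateRow Unit y) (Matrix.of fun _ _ => z) =
      (Matrix.fromBlocks P X₀ (replicateRow Unit y) Z₀).updateCol (Sum.inr ()) (Sum.elim x fun _ => z) := by
  ext (a | ⟨⟩) (b | ⟨⟩) <;> simp

omit [CommRing R] [Fintype ι] in
/-- the same bordered matrix as a ROW update. [folklore] -/
theorem bordered_eq_updateRow (P : Matrix ι ι R) (x y : ι → R) (z : R) (Y₀ : Matrix Unit ι R) (Z₀ : Matrix Unit Unit R) :
    Matrix.fromBlocks P (replicateCol Unit x) (replicateRow Unit y) (Matrix.of fun _ _ => z) =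
      (Matrix.fromBlocks P (replicateCol Unit x) Y₀ Z₀).updateRow (Sum.inr ()) (Sum.elim y fun _ => z) := by
  ext (a | ⟨⟩) (b | ⟨⟩) <;> simp [Matrix.updateRow_apply]

/-- the entries of `borderedMinors` in the `replicateCol`/`replicateRow` notation. [folklore] -/
theorem borderedMinors_apply' (P : Matrix ι ι R) (B : Matrix ι ν R) (C : Matrix μ ι R) (D : Matrix μ ν R) (i : μ) (j : ν) :
    borderedMinors P B C D i j =
      (Matrix.fromBlocks P (replicateCol Unit fun a => B a j) (replicateRow Unit (C i)) (Matrix.of fun _ _ => D i j)).det := by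
  rw [borderedMinors_apply]
  rfl

/-- **COLUMN STEP**: `∑ⱼ 𝔅 i j · w j = det [[P, B w], [C i, (D w) i]]`. [folklore] -/
theorem borderedMinors_mulVec_apply [Fintype ν] (P : Matrix ι ι R) (B : Matrix ι ν R) (C : Matrix μ ι R) (D : Matrix μ ν R)
    (w : ν → R) (i : μ) :
    (borderedMinors P B C D *ᵥ w) i =
      (Matrix.fromBlocks P (replicateCol Unit (B *ᵥ w)) (replicateRow Unit (C i)) (Matrix.of fun _ _ => (D *ᵥ w) i)).det := by
  have hsum : (∑ j, w j • (Sum.elim (fun a => B a j) (fun _ : Unit => D i j) : ι ⊕ Unit → R)) =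
      Sum.elim (B *ᵥ w) (fun _ => (D *ᵥ w) i) := by
    funext x
    rcases x with a | ⟨⟩ <;> simp [Finset.sum_apply, Matrix.mulVec, dotProduct, mul_comm]
  rw [Matrix.mulVec, dotProduct]
  simp_rw [borderedMinors_apply', bordered_eq_updateCol P _ (C i) _ 0 0]
  rw [← hsum, det_updateCol_finset_sum]
  exact Finset.sum_congr rfl fun j _ => mul_comm _ _

/-- **COMPRESSIONS OF THE BORDERED-MINOR MATRIX ARE BORDERED DETERMINANTS** (bilinearity of `det A[α ∪ {i}, α ∪ {j}]` in the
border, any commutative ring): `v ⬝ᵥ (𝔅 *ᵥ w) = det [[P, B w], [vᵀ C, vᵀ D w]]`. [this work] -/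
theorem dotProduct_borderedMinors_mulVec [Fintype μ] [Fintype ν] (P : Matrix ι ι R) (B : Matrix ι ν R) (C : Matrix μ ι R)
    (D : Matrix μ ν R) (v : μ → R) (w : ν → R) :
    v ⬝ᵥ (borderedMinors P B C D *ᵥ w) =
      (Matrix.fromBlocks P (replicateCol Unit (B *ᵥ w)) (replicateRow Unit (v ᵥ* C))
        (Matrix.of fun _ _ => v ⬝ᵥ (D *ᵥ w))).det := by
  have hsum : (∑ i, v i • (Sum.elim (C i) (fun _ : Unit => (D *ᵥ w) i) : ι ⊕ Unit → R)) =
      Sum.elim (v ᵥ* C) (fun _ => v ⬝ᵥ (D *ᵥ w)) := by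
    funext x
    rcases x with a | ⟨⟩ <;> simp [Finset.sum_apply, Matrix.vecMul, dotProduct]
  rw [dotProduct]
  simp_rw [borderedMinors_mulVec_apply, bordered_eq_updateRow P (B *ᵥ w) _ _ 0 0]
  rw [← hsum, det_updateRow_finset_sum]

/-- the bordered block matrix is a two-sided compression of `A = fromBlocks P B C D` by `[1 0; 0 row v]` and `[1 0; 0 col w]`.
[folklore] -/
theorem fromBlocks_compress [Fintype μ] [Fintype ν] [DecidableEq μ] [DecidableEq ν] (P : Matrix ι ι R) (B : Matrix ι ν R)
    (C : Matrix μ ι R) (D : Matrix μ ν R) (v : μ → R) (w : ν → R) :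
    Matrix.fromBlocks (1 : Matrix ι ι R) 0 0 (replicateRow Unit v) * Matrix.fromBlocks P B C D *
        Matrix.fromBlocks (1 : Matrix ι ι R) 0 0 (replicateCol Unit w) =
      Matrix.fromBlocks P (B * replicateCol Unit w) (replicateRow Unit v * C) (replicateRow Unit v * D * replicateCol Unit w) := by
  rw [Matrix.fromBlocks_multiply, Matrix.fromBlocks_multiply]
  simp [Matrix.mul_assoc]

/-- hence **`v ⬝ᵥ (𝔅 *ᵥ w) = det (L_v · A · L_wᵀ)`** with `L_v = [1 0; 0 vᵀ]`: every compression of `𝔅` is the determinant of a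
compression of `A` one unit larger than the pivot block. [this work] -/
theorem dotProduct_borderedMinors_mulVec_eq_det_compress [Fintype μ] [Fintype ν] [DecidableEq μ] [DecidableEq ν]
    (A : Matrix (ι ⊕ μ) (ι ⊕ ν) R) (v : μ → R) (w : ν → R) :
    v ⬝ᵥ (borderedMinors A.toBlocks₁₁ A.toBlocks₁₂ A.toBlocks₂₁ A.toBlocks₂₂ *ᵥ w) =
      (Matrix.fromBlocks (1 : Matrix ι ι R) 0 0 (replicateRow Unit v) * A *
        Matrix.fromBlocks (1 : Matrix ι ι R) 0 0 (replicateCol Unit w)).det := by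
  conv_rhs => rw [← Matrix.fromBlocks_toBlocks A]
  rw [fromBlocks_compress, dotProduct_borderedMinors_mulVec, ← Matrix.replicateCol_mulVec, ← Matrix.replicateRow_vecMul,
    Matrix.mul_assoc, ← Matrix.replicateCol_mulVec, ← Matrix.replicateRow_vecMul]
  rfl

end Bordered

/-! ## §4 Class reading of (h4): every one-dimensional compression of the Sylvester minor pencil obeys the size-`(|ι|+1)` law -/

section MinorPencil

variable {K : ℕ} {ι μ : Type*} [Fintype ι] [DecidableEq ι] [Fintype μ] [DecidableEq μ]

omit [DecidableEq μ] in
/-- the compression matrix `[1 0; 0 col v]`, re-indexed to the rows of the pencil, realises `L_v · G[e,e] · L_vᵀ` as `Q̂ᵀ G Q̂`.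
[folklore] -/
theorem compress_submatrix_eq {N : ℕ} (e : ι ⊕ μ ≃ Fin N) (G : Matrix (Fin N) (Fin N) ℝ[X]) (v : μ → ℝ) :
    (((Matrix.fromBlocks (1 : Matrix ι ι ℝ) 0 0 (replicateCol Unit v)).submatrix e.symm id).map Polynomial.C)ᵀ * G *
        ((Matrix.fromBlocks (1 : Matrix ι ι ℝ) 0 0 (replicateCol Unit v)).submatrix e.symm id).map Polynomial.C =
      Matrix.fromBlocks (1 : Matrix ι ι ℝ[X]) 0 0 (replicateRow Unit fun i => Polynomial.C (v i)) * G.submatrix e e *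
        Matrix.fromBlocks (1 : Matrix ι ι ℝ[X]) 0 0 (replicateCol Unit fun i => Polynomial.C (v i)) := by
  have hQ : ((Matrix.fromBlocks (1 : Matrix ι ι ℝ) 0 0 (replicateCol Unit v)).submatrix e.symm id).map Polynomial.C =
      (Matrix.fromBlocks (1 : Matrix ι ι ℝ[X]) 0 0 (replicateCol Unit fun i => Polynomial.C (v i))).submatrix e.symm id := by
    rw [← Matrix.submatrix_map, Matrix.fromBlocks_map]
    congr 1
    ext (a | a) (b | ⟨⟩) <;> simp [Matrix.one_apply]
  have hT : (((Matrix.fromBlocks (1 : Matrix ι ι ℝ) 0 0 (replicateCol Unit v)).submatrix e.symm id).map Polynomial.C)ᵀ =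
      (Matrix.fromBlocks (1 : Matrix ι ι ℝ[X]) 0 0 (replicateRow Unit fun i => Polynomial.C (v i))).submatrix id e.symm := by
    rw [hQ, Matrix.transpose_submatrix, Matrix.fromBlocks_transpose]
    simp
  have hG : G = (G.submatrix e e).submatrix e.symm e.symm := by
    rw [Matrix.submatrix_submatrix, Equiv.self_comp_symm, Matrix.submatrix_id_id]
  rw [hT, hQ]
  conv_lhs => rw [hG]
  rw [Matrix.submatrix_mul_equiv, Matrix.submatrix_mul_equiv, Matrix.submatrix_id_id]

/-- **(h4) IN CLASS CURRENCY.**  For a symmetric `N`-pencil `G = ∑ X^{dₗ} • Sₗ` on `d` split along `e : ι ⊕ μ ≃ Fin N` with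
Sylvester minor pencil `𝔅` (the bordered-minor matrix of `A = G[e, e]`) and ANY constant real vector `v : μ → ℝ`:
`vᵀ 𝔅 v` is the determinant of the symmetric `(|ι|+1)`-pencil `∑ X^{dₗ} • (Qᵀ Sₗ Q)`, `Q = [e_ι | v]`, on the SAME support, so
`Z₊(vᵀ 𝔅 v) ≤ B` whenever `PosRootLawOn s K B d`, `s = |ι| + 1` (`e' : ι ⊕ Unit ≃ Fin s`).  Memo `Lines/tower_graft-S5.md` §6,
handle (h4). [this work] -/
theorem card_posRoots_compression_borderedMinors_le {N s B : ℕ} {d : Fin K → ℕ} (e : ι ⊕ μ ≃ Fin N) (e' : ι ⊕ Unit ≃ Fin s)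
    (hB : PosRootLawOn s K B d) (S : Fin K → Matrix (Fin N) (Fin N) ℝ) (hS : ∀ l, (S l).IsSymm) (v : μ → ℝ) :
    let A := (∑ l, ((X : ℝ[X]) ^ d l) • (S l).map Polynomial.C).submatrix e e
    (((fun i => Polynomial.C (v i)) ⬝ᵥ
        (borderedMinors A.toBlocks₁₁ A.toBlocks₁₂ A.toBlocks₂₁ A.toBlocks₂₂ *ᵥ fun i => Polynomial.C (v i))).roots.toFinset.filter
      (fun t => 0 < t)).card ≤ B := by
  intro A
  rw [dotProduct_borderedMinors_mulVec_eq_det_compress, ← compress_submatrix_eq e _ v]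
  exact card_posRoots_det_compression_le e' hB S hS _

omit [Fintype μ] [DecidableEq μ] in
/-- a vector whose `μ`-part (in the splitting `e`) is a multiple of `v` lies in the column span of `[e_ι | v]`. [folklore] -/
theorem exists_compress_mulVec_eq {N : ℕ} (e : ι ⊕ μ ≃ Fin N) (v : μ → ℝ) (x : Fin N → ℝ) (hx : x ≠ 0) (c : ℝ)
    (hc : ∀ i : μ, x (e (Sum.inr i)) = c * v i) :
    ∃ u : ι ⊕ Unit → ℝ, u ≠ 0 ∧
      ((Matrix.fromBlocks (1 : Matrix ι ι ℝ) 0 0 (replicateCol Unit v)).submatrix e.symm id) *ᵥ u = x := by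
  refine ⟨Sum.elim (fun i => x (e (Sum.inl i))) (fun _ => c), ?_, ?_⟩
  · intro hu
    apply hx
    funext k
    have h1 : ∀ i : ι, x (e (Sum.inl i)) = 0 := fun i => by
      have := congr_fun hu (Sum.inl i); simpa using this
    have h2 : c = 0 := by have := congr_fun hu (Sum.inr ()); simpa using this
    rcases h : e.symm k with i | i
    · have hk : k = e (Sum.inl i) := by rw [← h, Equiv.apply_symm_apply]
      rw [hk, h1 i, Pi.zero_apply]
    · have hk : k = e (Sum.inr i) := by rw [← h, Equiv.apply_symm_apply]
      rw [hk, hc i, h2, zero_mul, Pi.zero_apply]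
  · funext k
    rcases h : e.symm k with i | i
    · have hk : k = e (Sum.inl i) := by rw [← h, Equiv.apply_symm_apply]
      simp [Matrix.mulVec, dotProduct, Matrix.submatrix_apply, Matrix.fromBlocks, Fintype.sum_sum_type, Matrix.one_apply, hk]
    · have hk : k = e (Sum.inr i) := by rw [← h, Equiv.apply_symm_apply]
      simp [Matrix.mulVec, dotProduct, Matrix.submatrix_apply, Matrix.fromBlocks, Fintype.sum_sum_type, hk, hc i, mul_comm]

/-- **THE ROTATION-COUNT LAW (headline).**  Let `G = ∑ X^{dₗ} • Sₗ` be a symmetric `N`-pencil on `d`, split along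
`e : ι ⊕ μ ≃ Fin N`, with Sylvester minor pencil `𝔅` (bordered minors of `A = G[e,e]` over the pivot block `ι`).  Suppose
finitely many constant real DIRECTIONS `v a : μ → ℝ` (`a ∈ fam`) capture the kernels: at every positive root `t` of `det G` some
non-zero kernel vector of `G(t)` has its `μ`-part equal to a multiple of some `v a` — «the kernel of `G(t)` does not rotate beyond
`|fam|` directions modulo the pivot coordinates» — and no compression `(v a)ᵀ 𝔅 (v a)` is the zero polynomial.  Then
`Z₊(det G) ≤ |fam| · B` whenever `PosRootLawOn s K B d`, `s = |ι| + 1`: the ROTATION COUNT times the class budget ONE unit above the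
pivot size — for the size-doubling split `N = 2s−1`, `|ι| = s−1` this is a size-`s` budget.  (Memo rev 2f: «the gap between every
compression has ≤ B positive roots and det 𝔅 has ≤ poly(s)·B positive roots is EIGENVECTOR ROTATION»; this is the zero-rotation /
finite-rotation end of that gap, by name.) [this work] -/
theorem card_posRoots_pencil_le_card_mul_of_kernel_directions {N s B : ℕ} {d : Fin K → ℕ} (e : ι ⊕ μ ≃ Fin N)
    (e' : ι ⊕ Unit ≃ Fin s) (hB : PosRootLawOn s K B d) (S : Fin K → Matrix (Fin N) (Fin N) ℝ) (hS : ∀ l, (S l).IsSymm)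
    {α : Type*} (fam : Finset α) (v : α → μ → ℝ)
    (hv : ∀ a ∈ fam,
      let A := (∑ l, ((X : ℝ[X]) ^ d l) • (S l).map Polynomial.C).submatrix e e
      ((fun i => Polynomial.C (v a i)) ⬝ᵥ
        (borderedMinors A.toBlocks₁₁ A.toBlocks₁₂ A.toBlocks₂₁ A.toBlocks₂₂ *ᵥ fun i => Polynomial.C (v a i))) ≠ 0)
    (h : ∀ t : ℝ, 0 < t → (∑ l, ((X : ℝ[X]) ^ d l) • (S l).map Polynomial.C).det.IsRoot t →
      ∃ a ∈ fam, ∃ x : Fin N → ℝ, x ≠ 0 ∧ (∑ l, (t ^ d l) • S l) *ᵥ x = 0 ∧ ∃ c : ℝ, ∀ i : μ, x (e (Sum.inr i)) = c * v a i) :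
    ((∑ l, ((X : ℝ[X]) ^ d l) • (S l).map Polynomial.C).det.roots.toFinset.filter (fun t => 0 < t)).card ≤ fam.card * B := by
  have hpencil : ∀ t : ℝ, (∑ l, ((X : ℝ[X]) ^ d l) • (S l).map Polynomial.C).map (Polynomial.eval t) = ∑ l, (t ^ d l) • S l := by
    intro t
    ext i j
    simp only [Matrix.map_apply, Matrix.sum_apply, Matrix.smul_apply, smul_eq_mul, Polynomial.eval_finsetSum,
      Polynomial.eval_mul, Polynomial.eval_pow, Polynomial.eval_X, Polynomial.eval_C]
  have key := card_posRoots_pencil_le_sum_of_kernel_confined fam (fun _ => s) (fun _ => B) (fun _ => e') (fun a _ => hB) S hS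
    (fun a => (Matrix.fromBlocks (1 : Matrix ι ι ℝ) 0 0 (replicateCol Unit (v a))).submatrix e.symm id) ?_ ?_
  · simpa using key
  · intro a ha
    rw [compress_submatrix_eq e _ (v a), ← dotProduct_borderedMinors_mulVec_eq_det_compress]
    exact hv a ha
  · intro t ht hroot
    obtain ⟨a, ha, x, hx, hker, c, hc⟩ := h t ht hroot
    obtain ⟨u, hu, hux⟩ := exists_compress_mulVec_eq e (v a) x hx c hc
    refine ⟨a, ha, u, hu, ?_⟩
    rw [hux, hpencil, hker]

end MinorPencil

end Summit.ValiantsHypothesis.ValiantsHypothesis.Theorems.KPlusLogSqLaw.TowerGraft
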